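import Summits.QuantumAdvantage.QuantumAdvantage.Theses.LinnikCubicClassGroups
import Literature.Computability.Cryptography.CubicClassSamplingLawParts

/-!
# Crux `LinnikCubicClassGroups.PureCubicClassGroupFBQP` (stmt-QuantumAdvantage-11544) — stub `stub_classSamplingLaw` (S5b-P6)

Line `arakelov-giant-step-cycle`. **P6, the per-unit sampling law of a shift-cell / coset table** (`ClaimSamplingLaw`,
`Literature/Computability/Cryptography/CubicClassSamplingSpecs.lean`): Fourier sampling one unit of a table with the
structure `ShiftCellCosetTable` gives a character law within `2^-e₆` (total variation) of the weight
`w₁ c = corrMass Q F₁ c / Q²` of the IDEALISED table `F₁` (coins and defects ignored), and `w₁` satisfies `UnitSamplingLaw`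
with the coupling `μ'_t = μ_t + 2^-s (2^ℓe)^-(T−t)`, accuracy `δ = 2u/2^ℓe`, inaccurate mass `≤ 2^-e₆` and near-uniformity
`1/8`. Pure harmonic analysis, no number theory; the proof is assembled from the `PeriodFinding*` bricks
(`corrMass_shiftCell` factorisation, twisted class sums = jittered coset box sums, window energy of one coset per character,
dual angles, run-table tails) through `CubicClassSamplingLawParts` (`samplingLaw_tv`, `samplingLaw_inaccurate`,
`samplingLaw_uniform`). [Hallgren 2005, §4; Kitaev 1995, §4]
-/

set_option linter.dupNamespace false

namespace Summit.QuantumAdvantage.QuantumAdvantage.Theorems.LinnikCubicClassGroups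

open Literature.Computability.Cryptography.PeriodFinding (corrMass chr)
open Literature.Computability.Cryptography.CubicClassSampling
open Literature.Computability.Cryptography

/-- (REGISTERED SIGNATURE — do not change.) **S5b-P6 `stub_classSamplingLaw`**: the per-unit law of Fourier sampling a shift-cell /
coset table (`ClaimSamplingLaw`, `Literature/Computability/Cryptography/CubicClassSamplingSpecs.lean`): witnesses
`μ'_t = μ_t + 2^-s (2^ℓe)^-(T−t)` and `w₁ = corrMass Q F₁ / Q²` for the idealised table `F₁`; total variation by
`samplingLaw_tv`, inaccurate mass by `samplingLaw_inaccurate`, near-uniformity by `samplingLaw_uniform`. -/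
theorem stub_classSamplingLaw : ClaimSamplingLaw := by
  intro T ℓe s ℓy ℓκ top Ncell hB u e₆ K₀ Ω _ F Λ _ F₀ cls σ C y μ Badκ D εκ εD hTab hT hs hℓκ hhB h1 hεκ hεD hε hu hM hN
    hKlo hKhi
  have hQ : 2 ^ (top + (ℓy - s) + s + ℓe * T) = (2 ^ ℓe) ^ T * (2 ^ s * 2 ^ (top + (ℓy - s))) := by
    rw [← pow_mul, ← pow_add, ← pow_add]; congr 1; ring
  have hQR : ((2 : ℝ) ^ (top + (ℓy - s) + s + ℓe * T)) = ((((2 ^ ℓe) ^ T * (2 ^ s * 2 ^ (top + (ℓy - s)))) : ℕ) : ℝ) := by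
    rw [← hQ]; push_cast; ring
  have hLq : 2 ^ CubicClassPost.PostParams.Lq ⟨T, ℓe, s, ℓy - s, top, K₀, hB⟩ =
      2 ^ (top + (ℓy - s)) * (2 ^ s * 2 ^ (ℓe * T)) := by
    show 2 ^ (top + (ℓy - s) + s + ℓe * T) = _
    rw [pow_add, pow_add, mul_assoc]
  have hδ : ((2 * u : ℝ) / 2 ^ ℓe) = 2 * (u : ℝ) / ((2 ^ ℓe : ℕ) : ℝ) := by push_cast; ring
  refine ⟨fun t => μ t + 1 / (((2 ^ s : ℕ) : ℝ) * ((2 ^ ℓe : ℕ) : ℝ) ^ (T - (t : ℕ))),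
    fun c => corrMass ((2 ^ ℓe) ^ T * (2 ^ s * 2 ^ (top + (ℓy - s))))
      (fun v => C (cls (v % (2 ^ ℓe) ^ T)) ((σ (v % (2 ^ ℓe) ^ T) + v / (2 ^ ℓe) ^ T) % 2 ^ s)) c /
      ((((2 ^ ℓe) ^ T * (2 ^ s * 2 ^ (top + (ℓy - s)))) : ℕ) : ℝ) ^ 2, ?_, ?_⟩
  · rw [hQ, hQR]
    exact samplingLaw_tv hTab hs hℓκ hε
  · unfold UnitSamplingLaw
    refine ⟨fun c => div_nonneg (PeriodFinding.corrMass_nonneg _ _ _) (sq_nonneg _), ?_, ?_⟩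
    · rw [hLq, hδ]
      exact samplingLaw_inaccurate hTab hT hhB h1 hu hM hN hKlo hKhi
    · intro kk ξ hξ
      rw [hLq, hδ]
      exact samplingLaw_uniform hTab hT hhB h1 hu hM hN hKlo hKhi kk ξ hξ

end Summit.QuantumAdvantage.QuantumAdvantage.Theorems.LinnikCubicClassGroups
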